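import Summits.FinalStateConjecture.FinalStateConjecture.Theses.LaminatedThreshold
import Literature.Geometry.Lorentzian.StabilityCauchy
import Literature.Geometry.Lorentzian.TameFamilyFarSurgery

/-!
# Crux-ideate sketch (ideator 1, round 1) for `LaminatedThreshold.TameExitsLocalise`
(stmt-FinalStateConjecture-16894)

First lemmas of two idea cards, typed over existing declarations (nothing asserted; open
statements are `def … : Prop`):

* card `causal-quarantine` — `TameFluxControl` (Q0, the quantitative no-screening input: far ADM
  energy fluxes are uniformly controlled along a tame family), `CoreSourced` (core-sourced
  exceptionality, the dual of the strategist's `LocallyIncurable`), `QuarantinedRobustness` (S2′: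
  tail-robustness of goodness along a REPARAMETRISED exit whose far modification is only tame-small,
  at core-sourced tail-smooth data).
* card `charge-ballast-gluing` — `SlavedTailGluing` (S1″: compact gluing onto the EXACT tail of `d⋆`
  with no KID hypothesis, at the price of a reparametrisation `σ` of the exit; the KID cokernel is
  fed by far-supported second-order ballast, `c = σ b ∼ −Q(b)/α`).
* `tameExitsLocalise_of_cards` — the two stubs and one honest residual compose to the crux BY NAME.
-/

noncomputable section

set_option linter.dupNamespace false

namespace Summit.FinalStateConjecture.FinalStateConjecture.Cruxes.TameExitsLocalise.Ideator1

open scoped Manifold ContDiff Topology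
open Literature.Geometry.Lorentzian
open Summit.FinalStateConjecture.FinalStateConjecture.Theses.LaminatedThreshold

section Vocabulary

variable {X : Type} [TopologicalSpace X] [ChartedSpace E3 X] [IsManifold (𝓡 3) ∞ X] [T2Space X]
  [SecondCountableTopology X] [ConnectedSpace X]

/-- GOOD datum — verbatim the summit's property (as in the birth and strategist sketches). -/
def Good (D : InitialDataSet (𝓡 3) X) : Prop :=
  (∃ 𝒟 : VacuumCauchyDevelopment D, 𝒟.IsMaximal) ∧
    ∀ 𝒟 : VacuumCauchyDevelopment D, 𝒟.IsMaximal →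
      Summit.FinalStateConjecture.HasCompleteNullInfinity 𝒟.toCauchyDevelopment ∧
        ∃ (O : Set 𝒟.carrier) (d : FinalStateDecomposition 𝒟.toSpacetime O 2),
          (∀ i, Kerr.IsSubextremal (d.mass i) (d.spin i)) ∧
            O = Summit.FinalStateConjecture.exteriorOf 𝒟.toCauchyDevelopment d.charted ∧
              Summit.FinalStateConjecture.RaysStayInClosure 𝒟.toCauchyDevelopment O ∧
                Summit.FinalStateConjecture.HasExhaustiveCharts d ∧
                  Summit.FinalStateConjecture.IsFutureOriented d

/-- Tail-smooth on the end `e` (strategist's class): DR rates to all orders. -/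
def TailSmooth (e : AFEnd X) (D : InitialDataSet (𝓡 3) X) : Prop :=
  ∃ M : ℝ, ∀ n : ℕ, e.IsStronglyAsymptoticallyFlatWith D M 1 2 n n

/-- **Core-sourced exceptionality** (dual of `LocallyIncurable`): there are a compact LOCUS `L` and a
screening budget `μ > 0` such that every admissible datum agreeing with `d⋆` on a neighbourhood of
`L`, whose far ADM energy fluxes on the end `e` never exceed those of `d⋆` by more than `μ`
(no screening mass parked in the far field), is exceptional. Intended instances: data whose MGHD
has a naked first singular boundary point with compact past `L` (domain of dependence decides the
critical phase; clothing it needs far-field mass comparable to its distance). -/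
def CoreSourced (e : AFEnd X) (dstar : InitialDataSet (𝓡 3) X) : Prop :=
  ∃ L : Set X, IsCompact L ∧ ∃ μ : ℝ, 0 < μ ∧
    ∀ d' ∈ admissibleVacuumData X,
      (∃ U : Set X, IsOpen U ∧ L ⊆ U ∧ ∀ x ∈ U, d'.h.inner x = dstar.h.inner x ∧ d'.k x = dstar.k x) →
      (∀ r : ℝ, e.R < r → e.admEnergyFlux d' r ≤ e.admEnergyFlux dstar r + μ) →
      ¬ Good d'

end Vocabulary

/-- **Q0 `TameFluxControl` (card `causal-quarantine`, first lemma; provable now, size M).** Along a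
tame family the ADM energy fluxes through ALL far coordinate spheres are uniformly close to those of
the base datum: `wDist → 0` bounds `r²|∂(h_c − h_0)|` beyond `e.R`, and the flux integrand is linear
in `∂h` over a sphere of area `4πr²`. This is the quantitative form of "no screening mass can be
parked anywhere in the tail of a tame exit". -/
def TameFluxControl : Prop :=
  ∀ (X : Type) [TopologicalSpace X] [ChartedSpace E3 X] [IsManifold (𝓡 3) ∞ X] [T2Space X]
    [SecondCountableTopology X] [ConnectedSpace X] (e : AFEnd X)
    (F : EuclideanSpace ℝ (Fin 1) → InitialDataSet (𝓡 3) X),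
    InitialDataSet.IsTameDataFamily e 1 F →
    ∀ η : ℝ, 0 < η → ∃ ε : ℝ, 0 < ε ∧ ∀ c : EuclideanSpace ℝ (Fin 1), ‖c‖ < ε →
      ∀ r : ℝ, e.R < r → |e.admEnergyFlux (F c) r - e.admEnergyFlux (F 0) r| ≤ η

/-- **S2′ `QuarantinedRobustness` (card `causal-quarantine`, load-bearing stub).** At an admissible,
tail-smooth, CORE-SOURCED `d⋆` with a tame admissible family `F` all of whose members `c ≠ 0` are good,
there is a threshold radius `R⋆` such that every jointly smooth admissible family `F'` through `d⋆`,
equal to `d⋆` off a compact set and equal INSIDE `R₁ ≥ R⋆` to the REPARAMETRISED exit `F (σ b)`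
(`σ` continuous, `σ 0 = 0`, `σ b ≠ 0` for `b ≠ 0`) — with NO smallness of `F' b − F (σ b)` beyond `R₁`
other than admissibility and joint smoothness — is good on a punctured window. Content: the critical
phase is causally sealed before the far field matters (quarantine), hiding needs mass (Q0 + a
Penrose-type bound), and what remains is post-critical settling under weak late incoming radiation. -/
def QuarantinedRobustness : Prop :=
  ∀ (X : Type) [TopologicalSpace X] [ChartedSpace E3 X] [IsManifold (𝓡 3) ∞ X] [T2Space X]
    [SecondCountableTopology X] [ConnectedSpace X] (e : AFEnd X) (dstar : InitialDataSet (𝓡 3) X)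
    (F : EuclideanSpace ℝ (Fin 1) → InitialDataSet (𝓡 3) X),
    dstar ∈ admissibleVacuumData X → TailSmooth e dstar → CoreSourced e dstar →
    InitialDataSet.IsTameDataFamily e 1 F → F 0 = dstar → (∀ c, F c ∈ admissibleVacuumData X) →
    (∀ c, c ≠ 0 → Good (F c)) →
    ∃ Rstar : ℝ, ∀ R₁ : ℝ, Rstar ≤ R₁ →
      ∀ (F' : EuclideanSpace ℝ (Fin 1) → InitialDataSet (𝓡 3) X)
        (σ : EuclideanSpace ℝ (Fin 1) → EuclideanSpace ℝ (Fin 1)),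
        InitialDataSet.IsSmoothDataFamily 1 F' → F' 0 = dstar → (∀ b, F' b ∈ admissibleVacuumData X) →
        (∃ C : Set X, IsCompact C ∧
          ∀ b, ∀ x ∉ C, (F' b).h.inner x = dstar.h.inner x ∧ (F' b).k x = dstar.k x) →
        Continuous σ → σ 0 = 0 → (∀ b, b ≠ 0 → σ b ≠ 0) →
        (∃ ε₁ : ℝ, 0 < ε₁ ∧ ∀ b, ‖b‖ < ε₁ → ∀ x ∉ e.far R₁,
          (F' b).h.inner x = (F (σ b)).h.inner x ∧ (F' b).k x = (F (σ b)).k x) →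
        ∃ ε : ℝ, 0 < ε ∧ ∀ b, b ≠ 0 → ‖b‖ < ε → Good (F' b)

/-- **S1″ `SlavedTailGluing` (card `charge-ballast-gluing`, first lemma / stub).** Compact gluing of
the exit members onto the EXACT tail of `d⋆`, with NO KID-freeness hypothesis: beyond every `R₀` there
are radii `R₀ ≤ R₁`, a jointly smooth, immersed, injective, admissible family `F'` through `d⋆`, equal
to `d⋆` off ONE compact set, a smooth reparametrisation `σ` of the exit parameter (`σ 0 = 0`,
`σ b ≠ 0` for `b ≠ 0`; `σ = id` across a KID-free collar, `σ b = −(Q(b)/α)` quadratic when the KID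
charges of the tail must be balanced at second order by far-supported ballast), and a window on which
`F' b = F (σ b)` inside `R₁`. -/
def SlavedTailGluing : Prop :=
  ∀ (X : Type) [TopologicalSpace X] [ChartedSpace E3 X] [IsManifold (𝓡 3) ∞ X] [T2Space X]
    [SecondCountableTopology X] [ConnectedSpace X] (e : AFEnd X) (dstar : InitialDataSet (𝓡 3) X)
    (F : EuclideanSpace ℝ (Fin 1) → InitialDataSet (𝓡 3) X),
    dstar ∈ admissibleVacuumData X → ¬ Good dstar →
    InitialDataSet.IsTameDataFamily e 1 F → InitialDataSet.IsImmersedAtZero 1 F → F 0 = dstar →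
    Function.Injective F → (∀ c, F c ∈ admissibleVacuumData X) →
    ∀ R₀ : ℝ, ∃ R₁ : ℝ, R₀ ≤ R₁ ∧
      ∃ (F' : EuclideanSpace ℝ (Fin 1) → InitialDataSet (𝓡 3) X)
        (σ : EuclideanSpace ℝ (Fin 1) → EuclideanSpace ℝ (Fin 1)) (ε₁ : ℝ),
        InitialDataSet.IsSmoothDataFamily 1 F' ∧ InitialDataSet.IsImmersedAtZero 1 F' ∧ F' 0 = dstar ∧
        Function.Injective F' ∧ (∀ b, F' b ∈ admissibleVacuumData X) ∧
        (∃ C : Set X, IsCompact C ∧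
          ∀ b, ∀ x ∉ C, (F' b).h.inner x = dstar.h.inner x ∧ (F' b).k x = dstar.k x) ∧
        Continuous σ ∧ σ 0 = 0 ∧ (∀ b, b ≠ 0 → σ b ≠ 0) ∧
        0 < ε₁ ∧
        ∀ b, ‖b‖ < ε₁ → ∀ x ∉ e.far R₁, (F' b).h.inner x = (F (σ b)).h.inner x ∧ (F' b).k x = (F (σ b)).k x

/-- **Residual (honest): the crux on the complementary class** — base data that are not tail-smooth on
the exit's end (where the strategist's geometric-optics datum lives: this half is the disprover's) or
not core-sourced (extremal-type / eternal-type exceptional data, where the far field can drive the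
critical phase for ever). -/
def ResidualClass : Prop :=
  ∀ (X : Type) [TopologicalSpace X] [ChartedSpace E3 X] [IsManifold (𝓡 3) ∞ X] [T2Space X]
    [SecondCountableTopology X] [ConnectedSpace X] (e : AFEnd X) (dstar : InitialDataSet (𝓡 3) X)
    (F : EuclideanSpace ℝ (Fin 1) → InitialDataSet (𝓡 3) X),
    dstar ∈ admissibleVacuumData X → ¬ Good dstar → ¬ (TailSmooth e dstar ∧ CoreSourced e dstar) →
    InitialDataSet.IsTameDataFamily e 1 F → InitialDataSet.IsImmersedAtZero 1 F → F 0 = dstar →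
    Function.Injective F → (∀ c, F c ∈ admissibleVacuumData X) → (∀ c, c ≠ 0 → Good (F c)) →
    ∃ F' : EuclideanSpace ℝ (Fin 1) → InitialDataSet (𝓡 3) X,
      InitialDataSet.IsSmoothDataFamily 1 F' ∧ InitialDataSet.IsImmersedAtZero 1 F' ∧ F' 0 = dstar ∧
      Function.Injective F' ∧ (∀ c, F' c ∈ admissibleVacuumData X) ∧
      (∃ C : Set X, IsCompact C ∧
        ∀ c, ∀ x ∉ C, (F' c).h.inner x = dstar.h.inner x ∧ (F' c).k x = dstar.k x) ∧
      ∃ ε : ℝ, 0 < ε ∧ ∀ c, c ≠ 0 → ‖c‖ < ε → Good (F' c)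

/-- The two card stubs and the residual compose to the crux BY NAME (sanity check of the typing; the
members `F' b` are good because `F (σ b)` is good for `b ≠ 0` — this is where the TWO-SIDEDNESS of the
hypothesis (`F c` good for every `c ≠ 0`, either sign) is consumed: `σ` may be one-signed). -/
theorem tameExitsLocalise_of_cards (hglue : SlavedTailGluing) (hrob : QuarantinedRobustness)
    (hres : ResidualClass) : TameExitsLocalise := by
  intro X _ _ _ _ _ _ dstar hD hbad hexit
  obtain ⟨e, F, hF, himm, h0, hinj, hadm, hgood⟩ := hexit
  by_cases hcls : TailSmooth e dstar ∧ CoreSourced e dstar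
  · obtain ⟨Rstar, hR⟩ := hrob X e dstar F hD hcls.1 hcls.2 hF h0 hadm hgood
    obtain ⟨R₁, hR₁, F', σ, ε₁, hF', himm', h0', hinj', hadm', hC', hσc, hσ0, hσne, hε₁, hcore⟩ :=
      hglue X e dstar F hD hbad hF himm h0 hinj hadm Rstar
    obtain ⟨ε, hε, hwin⟩ := hR R₁ hR₁ F' σ hF' h0' hadm' hC' hσc hσ0 hσne ⟨ε₁, hε₁, hcore⟩
    exact ⟨F', hF', himm', h0', hinj', hadm', hC', ε, hε, hwin⟩
  · exact hres X e dstar F hD hbad hcls hF himm h0 hinj hadm hgood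

end Summit.FinalStateConjecture.FinalStateConjecture.Cruxes.TameExitsLocalise.Ideator1

end
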